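import Literature.Probability.Percolation.SharpnessDCTProofs
import HarnessLib

/-!
# Crux `PercNonProliferation.FreeBoxSparse` (stmt-CriticalPhenomena-4445), line `ccfs-window-kissing-walls` —
# helper for stub `stub_collar`, part 3: the merging increment of the free volume functional

Helper file for the lead's skeleton of line `ccfs-window-kissing-walls`
(prover-line-stmt-CriticalPhenomena-4445-0); lands with `--supports stmt-CriticalPhenomena-4445`.

For a finite `Λ` and a configuration `ω` write `C_Λ(v) = {w ∈ Λ | v ↔ w inside Λ}` for the free piece
of `v` and `N_Λ(ω) = Σ_{v∈Λ} |C_Λ(v)| = Σ_{pieces K} |K|²` for the (unnormalised) free volume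
functional `π_Λ = N_Λ/|Λ|²`.  It is increasing in `ω` (`sum_card_piece_mono`), at most `|Λ|²`
(`sum_card_piece_le`), and — the lever of the sprinkling argument — if `ω ⊆ ω'` and two vertices
`x, y` NOT joined inside `Λ` under `ω` ARE joined under `ω'`, then
`N_Λ(ω') ≥ N_Λ(ω) + 2 |C_Λ(x)| |C_Λ(y)|` (`stub_collar_merge`: `t ↦ t²` is superadditive, the two
pieces are disjoint and both sit inside the new piece of each of their vertices).
-/

noncomputable section

namespace Summit.CriticalPhenomena.PercolationContinuityZ3.Theorems.FreeBoxSparse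

open Literature.Probability.Percolation
open scoped Classical

namespace StubCollar

open Finset

variable {V : Type*}

/-- `{a ↔ b in S}` is symmetric. [folklore] -/
theorem openConnIn_symm' {S : Set V} {a b : V} {ω : BondConfig V} (h : ω ∈ openConnIn S a b) :
    ω ∈ openConnIn S b a :=
  DCT16.mem_openConnIn_of_pathIn (DCT16.pathIn_of_mem_openConnIn h).symm

/-- `{a ↔ b in S}` is transitive. [folklore] -/
theorem openConnIn_trans' {S : Set V} {a b c : V} {ω : BondConfig V} (h₁ : ω ∈ openConnIn S a b)
    (h₂ : ω ∈ openConnIn S b c) : ω ∈ openConnIn S a c :=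
  DCT16.mem_openConnIn_of_pathIn
    ((DCT16.pathIn_of_mem_openConnIn h₁).trans (DCT16.pathIn_of_mem_openConnIn h₂))

/-- `{a ↔ b in S}` is increasing in the configuration. [folklore] -/
theorem openConnIn_of_subset {S : Set V} {a b : V} {ω ω' : BondConfig V} (hω : ω ⊆ ω')
    (h : ω ∈ openConnIn S a b) : ω' ∈ openConnIn S a b :=
  DCT16.mem_openConnIn_of_pathIn ((DCT16.pathIn_of_mem_openConnIn h).mono_graph (openGraph_mono hω))

/-- The free piece grows with the configuration. [folklore] -/
theorem piece_mono (Λ : Finset V) {ω ω' : BondConfig V} (hω : ω ⊆ ω') (v : V) :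
    (Λ.filter fun w => ω ∈ openConnIn (↑Λ : Set V) v w) ⊆
      Λ.filter fun w => ω' ∈ openConnIn (↑Λ : Set V) v w := by
  intro w hw
  rw [Finset.mem_filter] at hw ⊢
  exact ⟨hw.1, openConnIn_of_subset hω hw.2⟩

/-- The free piece of a vertex of `C_Λ(x)` lies in `C_Λ(x)`. [folklore] -/
theorem piece_subset_of_mem (Λ : Finset V) {ω : BondConfig V} {x v : V}
    (hv : v ∈ Λ.filter fun w => ω ∈ openConnIn (↑Λ : Set V) x w) :
    (Λ.filter fun w => ω ∈ openConnIn (↑Λ : Set V) v w) ⊆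
      Λ.filter fun w => ω ∈ openConnIn (↑Λ : Set V) x w := by
  intro w hw
  rw [Finset.mem_filter] at hv hw ⊢
  exact ⟨hw.1, openConnIn_trans' hv.2 hw.2⟩

/-- **The free volume functional is increasing**: `N_Λ(ω) ≤ N_Λ(ω')` for `ω ⊆ ω'`. [folklore] -/
theorem sum_card_piece_mono (Λ : Finset V) {ω ω' : BondConfig V} (hω : ω ⊆ ω') :
    ∑ v ∈ Λ, ((Λ.filter fun w => ω ∈ openConnIn (↑Λ : Set V) v w).card : ℝ) ≤
      ∑ v ∈ Λ, ((Λ.filter fun w => ω' ∈ openConnIn (↑Λ : Set V) v w).card : ℝ) :=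
  Finset.sum_le_sum fun v _ => by exact_mod_cast Finset.card_le_card (piece_mono Λ hω v)

/-- `0 ≤ N_Λ(ω) ≤ |Λ|²`. [folklore] -/
theorem sum_card_piece_le (Λ : Finset V) (ω : BondConfig V) :
    ∑ v ∈ Λ, ((Λ.filter fun w => ω ∈ openConnIn (↑Λ : Set V) v w).card : ℝ) ≤ (Λ.card : ℝ) ^ 2 :=
  calc ∑ v ∈ Λ, ((Λ.filter fun w => ω ∈ openConnIn (↑Λ : Set V) v w).card : ℝ)
      ≤ ∑ _v ∈ Λ, (Λ.card : ℝ) :=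
        Finset.sum_le_sum fun v _ => by exact_mod_cast Finset.card_le_card (Finset.filter_subset _ _)
    _ = (Λ.card : ℝ) ^ 2 := by rw [Finset.sum_const, nsmul_eq_mul]; ring

/-- **The merging increment** (natural-number form). If `ω ⊆ ω'` and `x, y` are not joined inside
`Λ` under `ω` but are under `ω'`, then `N_Λ(ω') ≥ N_Λ(ω) + 2|C_Λ(x)||C_Λ(y)|`. [folklore] -/
theorem merge_increment_nat (Λ : Finset V) {ω ω' : BondConfig V} (hω : ω ⊆ ω') {x y : V}
    (hxy : ω ∉ openConnIn (↑Λ : Set V) x y) (hxy' : ω' ∈ openConnIn (↑Λ : Set V) x y) :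
    ∑ v ∈ Λ, (Λ.filter fun w => ω ∈ openConnIn (↑Λ : Set V) v w).card +
        2 * ((Λ.filter fun w => ω ∈ openConnIn (↑Λ : Set V) x w).card *
          (Λ.filter fun w => ω ∈ openConnIn (↑Λ : Set V) y w).card) ≤
      ∑ v ∈ Λ, (Λ.filter fun w => ω' ∈ openConnIn (↑Λ : Set V) v w).card := by
  set Cx := Λ.filter fun w => ω ∈ openConnIn (↑Λ : Set V) x w with hCx
  set Cy := Λ.filter fun w => ω ∈ openConnIn (↑Λ : Set V) y w with hCy
  -- the two pieces are disjoint
  have hdisj : Disjoint Cx Cy := by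
    rw [Finset.disjoint_left]
    intro w hwx hwy
    rw [hCx, Finset.mem_filter] at hwx
    rw [hCy, Finset.mem_filter] at hwy
    exact hxy (openConnIn_trans' hwx.2 (openConnIn_symm' hwy.2))
  have hCxΛ : Cx ⊆ Λ := Finset.filter_subset _ _
  have hCyΛ : Cy ⊆ Λ := Finset.filter_subset _ _
  -- under `ω'`, the piece of a vertex of `C_Λ(x)` or `C_Λ(y)` contains `C_Λ(x) ∪ C_Λ(y)`
  have hbig : ∀ v, v ∈ Cx ∨ v ∈ Cy →
      Cx ∪ Cy ⊆ Λ.filter fun w => ω' ∈ openConnIn (↑Λ : Set V) v w := by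
    intro v hv w hw
    rw [Finset.mem_filter]
    rcases Finset.mem_union.1 hw with hw | hw
    · rw [hCx, Finset.mem_filter] at hw
      refine ⟨hw.1, ?_⟩
      rcases hv with hv | hv
      · rw [hCx, Finset.mem_filter] at hv
        exact openConnIn_of_subset hω (openConnIn_trans' (openConnIn_symm' hv.2) hw.2)
      · rw [hCy, Finset.mem_filter] at hv
        exact openConnIn_trans' (openConnIn_of_subset hω (openConnIn_symm' hv.2))
          (openConnIn_trans' (openConnIn_symm' hxy') (openConnIn_of_subset hω hw.2))
    · rw [hCy, Finset.mem_filter] at hw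
      refine ⟨hw.1, ?_⟩
      rcases hv with hv | hv
      · rw [hCx, Finset.mem_filter] at hv
        exact openConnIn_trans' (openConnIn_of_subset hω (openConnIn_symm' hv.2))
          (openConnIn_trans' hxy' (openConnIn_of_subset hω hw.2))
      · rw [hCy, Finset.mem_filter] at hv
        exact openConnIn_of_subset hω (openConnIn_trans' (openConnIn_symm' hv.2) hw.2)
  have hcard_union : (Cx ∪ Cy).card = Cx.card + Cy.card := Finset.card_union_of_disjoint hdisj
  -- pointwise bound
  have hpt : ∀ v ∈ Λ, (Λ.filter fun w => ω ∈ openConnIn (↑Λ : Set V) v w).card +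
      ((if v ∈ Cx then Cy.card else 0) + (if v ∈ Cy then Cx.card else 0)) ≤
      (Λ.filter fun w => ω' ∈ openConnIn (↑Λ : Set V) v w).card := by
    intro v _
    by_cases hvx : v ∈ Cx
    · have hvy : v ∉ Cy := Finset.disjoint_left.1 hdisj hvx
      rw [if_pos hvx, if_neg hvy, add_zero]
      have h1 : (Λ.filter fun w => ω ∈ openConnIn (↑Λ : Set V) v w).card ≤ Cx.card :=
        Finset.card_le_card (piece_subset_of_mem Λ hvx)
      have h2 := Finset.card_le_card (hbig v (Or.inl hvx))
      omega
    · by_cases hvy : v ∈ Cy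
      · rw [if_neg hvx, if_pos hvy, zero_add]
        have h1 : (Λ.filter fun w => ω ∈ openConnIn (↑Λ : Set V) v w).card ≤ Cy.card :=
          Finset.card_le_card (piece_subset_of_mem Λ hvy)
        have h2 := Finset.card_le_card (hbig v (Or.inr hvy))
        omega
      · rw [if_neg hvx, if_neg hvy, add_zero, add_zero]
        exact Finset.card_le_card (piece_mono Λ hω v)
  calc ∑ v ∈ Λ, (Λ.filter fun w => ω ∈ openConnIn (↑Λ : Set V) v w).card + 2 * (Cx.card * Cy.card)
      = ∑ v ∈ Λ, ((Λ.filter fun w => ω ∈ openConnIn (↑Λ : Set V) v w).card +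
          ((if v ∈ Cx then Cy.card else 0) + (if v ∈ Cy then Cx.card else 0))) := by
        rw [Finset.sum_add_distrib, Finset.sum_add_distrib, Finset.sum_ite_mem, Finset.sum_ite_mem,
          Finset.inter_eq_right.2 hCxΛ, Finset.inter_eq_right.2 hCyΛ, Finset.sum_const,
          Finset.sum_const, smul_eq_mul, smul_eq_mul]
        ring
    _ ≤ ∑ v ∈ Λ, (Λ.filter fun w => ω' ∈ openConnIn (↑Λ : Set V) v w).card :=
        Finset.sum_le_sum hpt

end StubCollar

/-- **Registered form of the merging increment** (the lever of K2 = collar rarity): if `ω ⊆ ω'` and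
`x, y` are not joined inside `Λ` under `ω` but are under `ω'`, then the free volume functional
`N_Λ = Σ_{v∈Λ} |C_Λ(v)|` increases by at least `2 |C_Λ(x)| |C_Λ(y)|`; in particular merging two
`δ`-dense free pieces raises `π_Λ = N_Λ/|Λ|²` by `≥ 2δ²`. [folklore] -/
theorem stub_collar_merge : ∀ {V : Type} (Λ : Finset V) (ω ω' : BondConfig V), ω ⊆ ω' → ∀ (x y : V), ω ∉ openConnIn (↑Λ : Set V) x y → ω' ∈ openConnIn (↑Λ : Set V) x y → (∑ v ∈ Λ, ((Λ.filter fun w => ω ∈ openConnIn (↑Λ : Set V) v w).card : ℝ)) + 2 * ((Λ.filter fun w => ω ∈ openConnIn (↑Λ : Set V) x w).card : ℝ) * ((Λ.filter fun w => ω ∈ openConnIn (↑Λ : Set V) y w).card : ℝ) ≤ ∑ v ∈ Λ, ((Λ.filter fun w => ω' ∈ openConnIn (↑Λ : Set V) v w).card : ℝ) := by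
  intro V Λ ω ω' hω x y hxy hxy'
  have h := StubCollar.merge_increment_nat Λ hω hxy hxy'
  have h' : ((∑ v ∈ Λ, (Λ.filter fun w => ω ∈ openConnIn (↑Λ : Set V) v w).card +
      2 * ((Λ.filter fun w => ω ∈ openConnIn (↑Λ : Set V) x w).card *
        (Λ.filter fun w => ω ∈ openConnIn (↑Λ : Set V) y w).card) : ℕ) : ℝ) ≤
      ((∑ v ∈ Λ, (Λ.filter fun w => ω' ∈ openConnIn (↑Λ : Set V) v w).card : ℕ) : ℝ) := by
    exact_mod_cast h
  push_cast at h'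
  linarith

end Summit.CriticalPhenomena.PercolationContinuityZ3.Theorems.FreeBoxSparse
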